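import Summits.HodgeConjecture.HodgeConjecture.Theorems.R90S9TestPairRealisation   -- ★ p862596 (this seat): `tensOfPair`, `tensOfPair_eq_tens₀`, `tensOfPair_of_not`, `trGp₀_tensOfPair_eq_archTr₀_mul_finprod_sph`
import Summits.HodgeConjecture.HodgeConjecture.Theorems.R90S9SphericalClassTuple    -- ★ p862412 (p02): `tupleOf`, `repOf` (the component record of a `K_c`-spherical class)
import Summits.HodgeConjecture.HodgeConjecture.Theorems.F0P3TraceFactorisationKcInvariance   -- ★ (A-p12): `tens₀_apply_mul_of_mem_cmCompactFactor`, `tens₀_apply_of_mem_cmCompactFactor_mul` (bi-`K_c`-invariance of `f′_{S,∞} ⊗ f^S`)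
import HarnessLib

/-!
# R90-TF · S9 «InnerForm-13.3.6 (c)» — TWO PINS OF RECORD ON THE REALISED TEST PAIRS `tensOfPair p`: `K_c`-bi-invariance (the `Transfer_cm` guard) and
# «`Θ₀ (tupleOf π′) p = tr π′ (tensOfPair p)`» (the `htr` discharger of the guarded spectral expansion) (Rogawski 1990 §14.2 p. 233, §14.5 p. 237, §14.6 p. 244)

Cell `hodgecm-mathlib`, crux H413 (`stmt-HodgeConjecture-24833`, lane `--supports … --as helper`), route of record `HCCMUnconditional` (count-neutral).  Programme R90-TF,
section S9 (base `R90-IF`); seat R90-IF-p05 (g0); default offers (xiii)+(xiv) of 22:37Z under RULING S9-R-TG-4 (R90-IF-plan 22:34:18Z: pins `X_cm.traceL := fun p => 𝔨.traceGp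
(tensOfPair … p)`, `Transfer_cm := fun p f => IsKcBiInv … (tensOfPair … p) ∧ 𝔨.Transfer (tensOfPair … p) f`, `X_cm.trPrime := fun π′ p => Θ₀ (tupleOf … π′) p`).  THEOREMS ONLY
(no `def`, no instance, no notation, no named fact, no `sorry`); never imports a `Cruxes/…/Lines` module; namespace `Summit.HodgeConjecture.HodgeConjecture.R90.S9`.
HONEST LABEL: HC_CM is proved only modulo the 7 printed citations (2 remaining named inputs: hLiu418 = stmt-HodgeConjecture-24832, h413 = stmt-HodgeConjecture-24833)
— until rung 0 closes.  §1 is UNCONDITIONAL; §2 is CONDITIONAL on the letter «ArchFinTraceSplit» + PH (inherited from ★ p862484, named hypotheses).  Bookkeeping only.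

## CONTENTS (all proved; axioms TRIO)
* §1 **`isKcBiInv_tensOfPair (p) : IsKcBiInv L ι H T hT (tensOfPair L H ι T hT p)`** — for EVERY bare pair: on the test predicate `tensOfPair p = tens₀ …` is bi-`K_c`-invariant
  (★ `tens₀_apply_of_mem_cmCompactFactor_mul` ∕ `tens₀_apply_mul_of_mem_cmCompactFactor`: `f′_∞ = f_ι ⊗ e_{K_c}`, RULING (V31)); off it `tensOfPair p = 0`.  Discharges the guard
  conjunct of `Transfer_cm` ∕ S9-R-b′ at every `p`.
* §2 **`theta₀_tupleOf_eq_trGp₀_tensOfPair`** — for every `𝓕₀`-pair `p` and every `π′ : RepPrimeSph …`: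
  `archTr₀ (tupleOf π′).1 p.1 · ∏ᶠ_v tr ((tupleOf π′).2 v)(p.2 v) = trGp₀ … π′.1 (tensOfPair p)` (★ p862596 §4; `tupleOf π′` unfolds to the component record at `repOf = rep`,
  `rfl`) — so with the pin `X_cm.trPrime := Θ₀ ∘ tupleOf` the hypothesis `htr` of ★ p862518 `chiExpansion_gammaSph_of_allClasses_tens₀` ∕ `_of_allClasses` holds ON ALL OF `𝓕₀`:
  **`trPrime_pin_eq_trGp₀_tensOfPair`** packages exactly that (`htrX → htr`), generic in any `trPrime : RepPrimeSph → pair → ℂ`.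
[cite: Rogawski1990, §14.2 p. 233; §14.5 p. 237; §14.6 Thm. 14.6.4 p. 244] [cite: BorelJacquet1979, §4.1 and §4.6] [cite: FlathCorvallis1979, Thm. 3 and Thm. 4]
-/

set_option autoImplicit false
-- the mandated namespace repeats `HodgeConjecture.HodgeConjecture`, as in every `Theorems/*.lean` of this sub-problem
set_option linter.dupNamespace false

noncomputable section

open NumberField IsDedekindDomain MeasureTheory Filter
open Literature.NumberTheory.Rogawski1990
open Literature.NumberTheory.Automorphic Literature.NumberTheory.Automorphic.UnitaryGroup
open Literature.NumberTheory.Automorphic.UnitaryGroup.CotangentForms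
open scoped Matrix Classical

open Summit.HodgeConjecture.HodgeConjecture.Cruxes.H413
open Summit.HodgeConjecture.HodgeConjecture.Cruxes.H413.F0P3InnerFormClassificationV6
open Summit.HodgeConjecture.HodgeConjecture.Cruxes.H413.F0P3ClassTokensOfRecord (Cls cl rep)
open Summit.HodgeConjecture.HodgeConjecture.Cruxes.H413.F0P3ClassTokenChoice (clFinChoice)
open Summit.HodgeConjecture.HodgeConjecture.Cruxes.H413.F0P3UnitaryLocOfRecord (clInfChoiceU)
open Summit.HodgeConjecture.HodgeConjecture.Cruxes.H413.F0P3TestFunctionsOfRecord (Unr₀)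
open Summit.HodgeConjecture.HodgeConjecture.Cruxes.H413.F0P3UnrTensorInstance (UnrTensor)
open Summit.HodgeConjecture.HodgeConjecture.Cruxes.H413.F0P3SpectralSideOfRecord (trGp₀)
open Summit.HodgeConjecture.HodgeConjecture.Cruxes.H413.F0P3SemilocalTestFunctionsOfRecord (TestS₀ tens₀)
open Summit.HodgeConjecture.HodgeConjecture.Cruxes.H413.F0P3TraceFactorisationKcInvariance
  (tens₀_apply_mul_of_mem_cmCompactFactor tens₀_apply_of_mem_cmCompactFactor_mul)
open Summit.HodgeConjecture.HodgeConjecture.Cruxes.H413.F0P3bArchDegOneClass (archDegOneClass)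
open Summit.HodgeConjecture.HodgeConjecture.Cruxes.H413.F0P3LettersTraceFactorisation (IsProductHaar)
open Summit.HodgeConjecture.HodgeConjecture.Cruxes.H413.F0P3LettersArchFinTraceSplit (ArchFinTraceSplit)

namespace Summit.HodgeConjecture.HodgeConjecture.R90.S9

open InnerFormSec146

variable (L : Type) [Field L] [NumberField L] [IsCMField L] (H : Matrix (Fin 3) (Fin 3) L) (ι : L →+* ℂ) (T : GL (Fin 3) ℂ)
  (hT : (T : Matrix (Fin 3) (Fin 3) ℂ)ᴴ * H.map ι * (T : Matrix (Fin 3) (Fin 3) ℂ) = Literature.Geometry.ComplexHyperbolic.BallModel.J)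

/-! ## §1 `tensOfPair p` is bi-`K_c`-invariant, for every pair -/

/-- **`tensOfPair p` IS BI-`K_c`-INVARIANT** (★ `IsKcSpherical`'s test-side twin `IsKcBiInv`), for EVERY bare pair `p`: on the test predicate it is `tens₀` of a presentation, whose
archimedean factor `f′_∞ = f_ι ⊗ e_{K_c}` is left and right `K_c`-invariant and whose finite factors do not see `K_c` (★ `tens₀_apply_of_mem_cmCompactFactor_mul` ∕
`tens₀_apply_mul_of_mem_cmCompactFactor`); off the predicate it is `0`.  The guard conjunct of `Transfer_cm` (RULING S9-R-TG-4). [cite: Rogawski1990, §14.2 p. 233; §14.6 p. 244]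
[cite: BorelJacquet1979, §4.1] -/
theorem isKcBiInv_tensOfPair
    (p : (UnitaryGroup.arch (↥(maximalRealSubfield L)) L (IsCMField.complexConj L) 3 H → ℂ) × (∀ v : Places L, (cmDatum L 3 H).Local v → ℂ)) :
    IsKcBiInv L ι H T hT (tensOfPair L H ι T hT p) := by
  intro k hk g
  by_cases h : ArchTestKc L ι H T hT p.1 ∧ (∀ v : Places L, IsLocallyConstant (p.2 v) ∧ HasCompactSupport (p.2 v)) ∧
      {v : Places L | p.2 v ≠ (cmLocalIntegralLevel L 3 H v : Set ((cmDatum L 3 H).Local v)).indicator fun _ => (1 : ℂ)}.Finite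
  · have h₁ : ∀ v : Places L, v ∉ h.2.2.toFinset →
        p.2 v = (cmLocalIntegralLevel L 3 H v : Set ((cmDatum L 3 H).Local v)).indicator fun _ => (1 : ℂ) := by
      intro v hv
      by_contra hne
      exact hv (h.2.2.mem_toFinset.2 hne)
    rw [tensOfPair_eq_tens₀ L H ι T hT h h.2.2.toFinset h₁]
    exact ⟨tens₀_apply_of_mem_cmCompactFactor_mul _ _ hk g, tens₀_apply_mul_of_mem_cmCompactFactor _ _ hk g⟩
  · rw [tensOfPair_of_not L H ι T hT h]
    exact ⟨rfl, rfl⟩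

/-! ## §2 `Θ₀ (tupleOf π′) p = tr π′ (tensOfPair p)` on the test predicate -/

variable (μA : Measure (Gp L H).automorphicQuotient) [(Gp L H).IsAutomorphicMeasure μA]
  [MeasurableSpace (Gp L H).Adelic] [BorelSpace (Gp L H).Adelic]
  (ν : Measure (Gp L H).Adelic) [IsFiniteMeasureOnCompacts ν]
  (νinf : @Measure (UnitaryGroup.arch (↥(maximalRealSubfield L)) L (IsCMField.complexConj L) 3 H) (borel _))
  (μv : ∀ v : Places L, @Measure ((cmDatum L 3 H).Local v) (borel _))

/-- **★ p862002's PRODUCT CHARACTER AT `tupleOf π′` IS THE CLASS CHARACTER ON `tensOfPair p`**: for every `𝓕₀`-pair `p` and every `K_c`-spherical class `π′`,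
`archTr₀ (tupleOf π′).1 p.1 · ∏ᶠ_v tr ((tupleOf π′).2 v)(p.2 v) = trGp₀ … π′.1 (tensOfPair p)` — ★ p862596 §4 with p02's `tupleOf π′ = (clInfChoiceU … [J⁺] (repOf π′.1), clFinChoice (repOf π′.1))`
(`repOf = Quotient.out = rep`, all `rfl`).  Modulo «ArchFinTraceSplit» + PH; `H` anisotropic. [cite: Rogawski1990, §14.5 p. 237; §14.6 Thm. 14.6.4 p. 244]
[cite: FlathCorvallis1979, Thm. 3 and Thm. 4] [cite: BorelJacquet1979, §4.6] -/
theorem theta₀_tupleOf_eq_trGp₀_tensOfPair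
    (hanis : ∀ x : Fin 3 → L, Literature.AlgebraicGeometry.ShimuraVarieties.hermForm (cmConjRingHom L) H x x = 0 → x = 0)
    (hAFS : ArchFinTraceSplit L H ι T hT μA ν νinf μv) (hPH : IsProductHaar L H ν νinf μv)
    (p : (UnitaryGroup.arch (↥(maximalRealSubfield L)) L (IsCMField.complexConj L) 3 H → ℂ) × (∀ v : Places L, (cmDatum L 3 H).Local v → ℂ))
    (h : ArchTestKc L ι H T hT p.1 ∧ (∀ v : Places L, IsLocallyConstant (p.2 v) ∧ HasCompactSupport (p.2 v)) ∧
      {v : Places L | p.2 v ≠ (cmLocalIntegralLevel L 3 H v : Set ((cmDatum L 3 H).Local v)).indicator fun _ => (1 : ℂ)}.Finite)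
    (π' : RepPrimeSph L ι H T hT μA) :
    UnitaryGroup.archTr₀ L ι H T hT νinf (tupleOf L ι H T hT μA π').1 p.1 *
        ∏ᶠ v : Places L, (letI : MeasurableSpace ((cmDatum L 3 H).Local v) := borel _;
          ((tupleOf L ι H T hT μA π').2 v).smoothTrace (μv v) (p.2 v)) =
      trGp₀ (Gp L H) μA ν π'.1 (tensOfPair L H ι T hT p) := by
  rw [trGp₀_tensOfPair_eq_archTr₀_mul_finprod_sph L H ι T hT μA ν νinf μv hanis hAFS hPH p h π']
  rfl

/-- **THE `htr` DISCHARGER AT THE PINS OF RECORD** (`htrX → htr` for ★ p862518): for ANY candidate `trPrime : RepPrimeSph → pair → ℂ` satisfying the pin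
`htrX : trPrime π′ p = Θ₀ (tupleOf π′) p` (S9-R-TG: `X_cm.trPrime` by `rfl`), and every `𝓕₀`-pair `p`: `trPrime π′ p = trGp₀ … π′.1 (tensOfPair p)` — the hypothesis `htr` of ★
`chiExpansion_gammaSph_of_allClasses_tens₀` ∕ `_of_allClasses` (with `χ c p := trGp₀ … c (tensOfPair p)`) at `X_cm`, on all of `𝓕₀`.  Modulo «ArchFinTraceSplit» + PH; `H` anisotropic.
[cite: Rogawski1990, §14.5 p. 237; §14.6 Thm. 14.6.4 p. 244] [cite: FlathCorvallis1979, Thm. 3 and Thm. 4] -/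
theorem trPrime_pin_eq_trGp₀_tensOfPair
    (hanis : ∀ x : Fin 3 → L, Literature.AlgebraicGeometry.ShimuraVarieties.hermForm (cmConjRingHom L) H x x = 0 → x = 0)
    (hAFS : ArchFinTraceSplit L H ι T hT μA ν νinf μv) (hPH : IsProductHaar L H ν νinf μv)
    (trPrime : RepPrimeSph L ι H T hT μA →
      (UnitaryGroup.arch (↥(maximalRealSubfield L)) L (IsCMField.complexConj L) 3 H → ℂ) × (∀ v : Places L, (cmDatum L 3 H).Local v → ℂ) → ℂ)
    (htrX : ∀ (π' : RepPrimeSph L ι H T hT μA) (p : (UnitaryGroup.arch (↥(maximalRealSubfield L)) L (IsCMField.complexConj L) 3 H → ℂ) ×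
        (∀ v : Places L, (cmDatum L 3 H).Local v → ℂ)),
      trPrime π' p = UnitaryGroup.archTr₀ L ι H T hT νinf (tupleOf L ι H T hT μA π').1 p.1 *
        ∏ᶠ v : Places L, (letI : MeasurableSpace ((cmDatum L 3 H).Local v) := borel _;
          ((tupleOf L ι H T hT μA π').2 v).smoothTrace (μv v) (p.2 v)))
    (π' : RepPrimeSph L ι H T hT μA)
    (p : (UnitaryGroup.arch (↥(maximalRealSubfield L)) L (IsCMField.complexConj L) 3 H → ℂ) × (∀ v : Places L, (cmDatum L 3 H).Local v → ℂ))
    (h : ArchTestKc L ι H T hT p.1 ∧ (∀ v : Places L, IsLocallyConstant (p.2 v) ∧ HasCompactSupport (p.2 v)) ∧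
      {v : Places L | p.2 v ≠ (cmLocalIntegralLevel L 3 H v : Set ((cmDatum L 3 H).Local v)).indicator fun _ => (1 : ℂ)}.Finite) :
    trPrime π' p = trGp₀ (Gp L H) μA ν π'.1 (tensOfPair L H ι T hT p) := by
  rw [htrX π' p]
  exact theta₀_tupleOf_eq_trGp₀_tensOfPair L H ι T hT μA ν νinf μv hanis hAFS hPH p h π'

end Summit.HodgeConjecture.HodgeConjecture.R90.S9

end
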